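import Summits.ValiantsHypothesis.ValiantsHypothesis.Theorems.KPlusLogSqLawTropicalBToeplitz
import Summits.ValiantsHypothesis.ValiantsHypothesis.Theorems.LacunarySymmetroidMatrixDescartesCensusTropicalKLawStatic

/-!
# Route `KPlusLogSqLaw`, crux `TropicalB` — the Toeplitz reduction: chains are bounded by plane shadows of linear instances

HONEST FRAMING.  Helper file for the crux `Summit.ValiantsHypothesis.ValiantsHypothesis.Theses.KPlusLogSqLaw.TropicalB`
(ledger item `stmt-ValiantsHypothesis-19771`; cell `pub-symmetroid`, seat `val-sym-trop-p2`, 2026-08-26).  Nothing here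
proves the registered stub `stub_tropFat`; nothing asserts `TropicalB`, `KPlusLogSqLaw`, `MatrixDescartes` or anything about
`VP ≠ VNP`.  This is a CONDITIONAL REDUCTION inside the TOEPLITZ sector (`v a b l = f (a − b) l`, `ε a b l = g (a − b) l`
over `ℤ`; see `…TropicalBToeplitz`): its hypothesis is a bound `Φ` on a purely combinatorial quantity — the number of
permutations of `Fin m` that are unique optima along a LINEAR Toeplitz parametric assignment problem — which the seat's exact
data (`m ≤ 8`) suggest is `≈ 4m − 7` («Conjecture T», OPEN, memo `HOME/val-sym-trop-p2/REGISTERS.md` §R7).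

* No definition is introduced: the hypothesis «linear Toeplitz shadow bound `Φ`» is spelled out inline in the theorem as a
  `∀`-statement over linear instances `(ψ, α)` with an admissible displacement set `P`; entrywise strict optimality of the
  classes of a dominant term is the tree's `TropicalCensus.score_lt_of_dominant` (`…TropicalKLawStatic`).
* `toeplitz_chain_le_of_linearBound` — **the reduction**: if every linear Toeplitz instance of size `m` has at most `Φ`
  pairwise distinct permutations that are unique optima (among the permutations whose displacements are admissible) at
  strictly increasing integer slopes, then every sign-alternating dominant chain of every Toeplitz design of format `(m, K)`
  has `n + 1 ≤ (2·((2m+1)·K·K) + 1) · Φ` terms.  Proof: the integer potential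
  `Ψ(θ) = #{(δ, l, l', e) : d l' < d l, θ·d l' − f δ l' + e ≤ θ·d l − f δ l}` (`δ ∈ [−m, m]`, `e ∈ {0,1}`) is monotone in `θ`,
  takes at most `2(2m+1)K² + 1` values along the chain, and two chain slopes with the same potential induce the same comparison
  pattern between all class lines at every displacement; on such a level one argmax selection `c : ℤ → Fin K` of present
  classes serves every index, the class map of each chain term IS `c ∘ displacement` (`score_lt_of_dominant`), the chain's
  permutations on the level are pairwise distinct, and each is the unique optimum of the linear instance
  `(ψ, α) = (d ∘ c, −f(·, c ·))` at its slope — so the level has at most `Φ` indices.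
So inside the Toeplitz sector `TropicalB` (indeed a POLYNOMIAL law `T = O(m K² Φ)`) follows from any polynomial bound on
plane shadows of the displacement-profile polytope; counting gives nothing of the kind (`≈ 2.4^m` unique-profile candidates).

References: folklore (parametric linearisation of a piecewise-linear objective); `eq_of_isDominant`, `tropWeight_eq_sum`
(`…TropicalBSymmetry`), `TropicalCensus.score_lt_of_dominant` (`…TropicalKLawStatic`), `stub_dominantInjective` (tree).
-/

set_option linter.dupNamespace false
set_option autoImplicit false

namespace Summit.ValiantsHypothesis.ValiantsHypothesis.Theorems.KPlusLogSqLaw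

open Summit.ValiantsHypothesis.ValiantsHypothesis.Theorems.MatrixDescartes.Negative
open Summit.ValiantsHypothesis.ValiantsHypothesis.Theorems.LacunarySymmetroidMatrixDescartes
open Summit.ValiantsHypothesis.ValiantsHypothesis.Theorems.LacunarySymmetroidMatrixDescartes.TropicalCensus
open scoped BigOperators
open Finset

/-! ## The Toeplitz reduction -/

section Reduction

variable {m K : ℕ}

/-- displacements of permutations of `Fin m` lie in `[−m, m]`. [folklore] -/
private theorem displ_mem_range (σ : Equiv.Perm (Fin m)) (b : Fin m) :
    -(m : ℤ) ≤ (σ b : ℤ) - (b : ℤ) ∧ (σ b : ℤ) - (b : ℤ) ≤ m := by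
  have h1 := (σ b).isLt
  have h2 := b.isLt
  constructor <;> omega

/-- **The Toeplitz reduction.**  Let `Φ` bound, for every LINEAR Toeplitz instance of size `m` — slopes `ψ : ℤ → ℤ` and
intercepts `α : ℤ → ℤ` on the displacements, and a set `P` of admissible displacements — the number of pairwise distinct
permutations `τ₀, …, τ_N` (all displacements admissible) such that `τ_k` is the UNIQUE maximiser, among permutations with
admissible displacements, of `Σ_b (θ'_k·ψ(τ b − b) + α(τ b − b))` at strictly increasing integer slopes `θ'_0 < … < θ'_N`:
`N + 1 ≤ Φ`.  Then every sign-alternating dominant chain of every TOEPLITZ design of format `(m, K)` has at most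
`(2·((2m+1)·K·K) + 1)·Φ` terms. [folklore] -/
theorem toeplitz_chain_le_of_linearBound (Φ : ℕ)
    (hΦ : ∀ (ψ α : ℤ → ℤ) (P : ℤ → Prop) (N : ℕ) (θ' : Fin (N + 1) → ℤ) (τ : Fin (N + 1) → Equiv.Perm (Fin m)),
      StrictMono θ' → Function.Injective τ → (∀ k b, P ((τ k b : ℤ) - (b : ℤ))) →
      (∀ k (σ' : Equiv.Perm (Fin m)), σ' ≠ τ k → (∀ b, P ((σ' b : ℤ) - (b : ℤ))) →
        ∑ b, (θ' k * ψ ((σ' b : ℤ) - (b : ℤ)) + α ((σ' b : ℤ) - (b : ℤ))) <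
          ∑ b, (θ' k * ψ ((τ k b : ℤ) - (b : ℤ)) + α ((τ k b : ℤ) - (b : ℤ)))) →
      N + 1 ≤ Φ)
    (d : Fin K → ℕ) (f g : ℤ → Fin K → ℤ) (n : ℕ) (θ : Fin (n + 1) → ℤ)
    (p : Fin (n + 1) → Equiv.Perm (Fin m) × (Fin m → Fin K)) (hθ : StrictMono θ)
    (hdom : ∀ k, IsDominant d (fun a b l => f ((a : ℤ) - b) l) (fun a b l => g ((a : ℤ) - b) l) (θ k) (p k))
    (halt : ∀ k : Fin n, termSign (fun a b l => g ((a : ℤ) - b) l) (p k.castSucc) *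
      termSign (fun a b l => g ((a : ℤ) - b) l) (p k.succ) < 0) :
    n + 1 ≤ (2 * ((2 * m + 1) * K * K) + 1) * Φ := by
  classical
  -- `Φ ≥ 1`: the one-element family `id` with only the displacement `0` admissible
  have hΦ1 : 1 ≤ Φ := by
    refine hΦ (fun _ => 0) (fun _ => 0) (fun δ => δ = 0) 0 (fun _ => 0) (fun _ => 1) (fun a b h => ?_)
      (fun a b _ => Fin.ext (by have := a.isLt; have := b.isLt; omega)) (fun k b => by simp) (fun k σ' hσ' hP => ?_)
    · exfalso
      have h' := Fin.lt_def.mp h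
      have := a.isLt; have := b.isLt
      omega
    · exfalso
      apply hσ'
      ext b
      have := hP b
      have h2 : (σ' b : ℤ) = b := by linarith
      exact_mod_cast h2
  rcases Nat.eq_zero_or_pos m with hm | hm
  · -- `m = 0`: all terms coincide, the chain has one term
    subst hm
    have hn : n = 0 := by
      rcases Nat.eq_zero_or_pos n with h0 | hpos
      · exact h0
      · exfalso
        have h := halt ⟨0, hpos⟩
        have heq : p (⟨0, hpos⟩ : Fin n).castSucc = p (⟨0, hpos⟩ : Fin n).succ := Subsingleton.elim _ _
        rw [heq] at h
        exact absurd h (not_lt.mpr (mul_self_nonneg _))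
    subst hn
    calc 0 + 1 = 1 * 1 := rfl
      _ ≤ (2 * ((2 * 0 + 1) * K * K) + 1) * Φ := Nat.mul_le_mul (Nat.le_add_left _ _) hΦ1
  -- `m ≥ 1`
  have hinj : Function.Injective p := stub_dominantInjective m K d _ _ n θ p hθ hdom halt
  obtain ⟨l₀⟩ : Nonempty (Fin K) := ⟨(p 0).2 ⟨0, hm⟩⟩
  -- the comparison set at a slope `t`: quadruples `(δ, l, l', e)` with `d l' < d l` and
  -- `t·d l' − f δ l' + e ≤ t·d l − f δ l` (`δ ∈ [−m, m]`, `e ∈ {0,1}`); its cardinality is the monotone potential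
  set cmp : ℤ → Finset (ℤ × Fin K × Fin K × Fin 2) := fun t =>
    (Finset.Icc (-(m : ℤ)) m ×ˢ (univ : Finset (Fin K)) ×ˢ (univ : Finset (Fin K)) ×ˢ (univ : Finset (Fin 2))).filter
      fun q => d q.2.1 > d q.2.2.1 ∧ t * d q.2.2.1 - f q.1 q.2.2.1 + (q.2.2.2 : ℕ) ≤ t * d q.2.1 - f q.1 q.2.1
    with hcmp
  have mem_cmp : ∀ (t δ : ℤ) (a b : Fin K) (e : Fin 2), (δ, a, b, e) ∈ cmp t ↔
      (-(m : ℤ) ≤ δ ∧ δ ≤ m) ∧ d b < d a ∧ t * d b - f δ b + (e : ℕ) ≤ t * d a - f δ a := by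
    intro t δ a b e
    simp only [hcmp, mem_filter, mem_product, mem_Icc, mem_univ, and_true, gt_iff_lt]
  have cmp_mono : ∀ t t' : ℤ, t ≤ t' → cmp t ⊆ cmp t' := by
    intro t t' htt q hq
    obtain ⟨δ, a, b, e⟩ := q
    rw [mem_cmp] at hq ⊢
    refine ⟨hq.1, hq.2.1, ?_⟩
    have h1 := hq.2.2
    have h2 : (d b : ℤ) < d a := by exact_mod_cast hq.2.1
    nlinarith
  have cmp_card : ∀ t : ℤ, (cmp t).card ≤ 2 * ((2 * m + 1) * K * K) := by
    intro t
    simp only [hcmp]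
    refine (card_filter_le _ _).trans ?_
    rw [card_product, card_product, card_product, Int.card_Icc]
    simp only [card_univ, Fintype.card_fin]
    have : ((m : ℤ) + 1 - -(m : ℤ)).toNat = 2 * m + 1 := by omega
    rw [this]
    nlinarith
  -- equal comparison sets ⇒ equal order between any two class lines at any displacement in range
  have cmp_iff : ∀ t t' : ℤ, cmp t = cmp t' → ∀ δ : ℤ, (-(m : ℤ) ≤ δ ∧ δ ≤ m) → ∀ l l' : Fin K,
      (t * d l' - f δ l' ≤ t * d l - f δ l ↔ t' * d l' - f δ l' ≤ t' * d l - f δ l) := by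
    intro t t' h δ hδ l l'
    have key : ∀ (a b : Fin K) (e : Fin 2), d b < d a →
        (t * d b - f δ b + (e : ℕ) ≤ t * d a - f δ a ↔ t' * d b - f δ b + (e : ℕ) ≤ t' * d a - f δ a) := by
      intro a b e hab
      have h0 := mem_cmp t δ a b e
      have h0' := mem_cmp t' δ a b e
      rw [h] at h0
      constructor
      · intro hh; exact ((h0'.mp (h0.mpr ⟨hδ, hab, hh⟩)).2.2)
      · intro hh; exact ((h0.mp (h0'.mpr ⟨hδ, hab, hh⟩)).2.2)
    rcases lt_trichotomy (d l') (d l) with hlt | heq | hgt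
    · have h0 := key l l' 0 hlt
      simp only [Fin.val_zero, Nat.cast_zero, add_zero] at h0
      exact h0
    · rw [heq]
      constructor <;> intro hh <;> linarith
    · have h1 := key l' l 1 hgt
      simp only [Fin.val_one, Nat.cast_one] at h1
      constructor
      · intro hh
        by_contra hc
        push Not at hc
        have := h1.mpr (by omega)
        omega
      · intro hh
        by_contra hc
        push Not at hc
        have := h1.mp (by omega)
        omega
  -- the potential level of each chain index
  let lev : Fin (n + 1) → ℕ := fun k => (cmp (θ k)).card
  have hlev_le : ∀ k, lev k ≤ 2 * ((2 * m + 1) * K * K) := fun k => cmp_card (θ k)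
  have hlev_eq : ∀ k k', lev k = lev k' → cmp (θ k) = cmp (θ k') := by
    intro k k' h
    rcases le_total k k' with hkk | hkk
    · exact eq_of_subset_of_card_le (cmp_mono _ _ (hθ.monotone hkk)) (le_of_eq h.symm)
    · exact (eq_of_subset_of_card_le (cmp_mono _ _ (hθ.monotone hkk)) (le_of_eq h)).symm
  -- presence of a class at a displacement
  let Pres : ℤ → Prop := fun δ => ∃ l : Fin K, g δ l ≠ 0
  -- every displacement used by a chain term has a present class (its own)
  have hpres : ∀ k b, g (((p k).1 b : ℤ) - (b : ℤ)) ((p k).2 b) ≠ 0 := by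
    intro k b
    have h := (mul_ne_zero_iff.mp (hdom k).1).2
    rw [prod_ne_zero_iff] at h
    exact h b (mem_univ _)
  -- STEP A: a level of the potential carries at most `Φ` chain indices
  have level_bound : ∀ L : ℕ, (univ.filter fun k => lev k = L).card ≤ Φ := by
    intro L
    set S := univ.filter fun k => lev k = L with hS
    rcases Nat.eq_zero_or_pos S.card with h0 | hpos
    · rw [h0]; exact Nat.zero_le _
    obtain ⟨k₀, hk₀⟩ := card_pos.mp hpos
    have hk₀L : lev k₀ = L := (mem_filter.mp hk₀).2
    -- argmax selection of present classes at the slope `θ k₀`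
    have hsel : ∀ δ : ℤ, ∃ c : Fin K, Pres δ → (g δ c ≠ 0 ∧ ∀ l, g δ l ≠ 0 →
        θ k₀ * d l - f δ l ≤ θ k₀ * d c - f δ c) := by
      intro δ
      by_cases hP : Pres δ
      · obtain ⟨l₁, hl₁⟩ := hP
        have hne : (univ.filter fun l : Fin K => g δ l ≠ 0).Nonempty := ⟨l₁, mem_filter.mpr ⟨mem_univ _, hl₁⟩⟩
        obtain ⟨c, hc, hmax⟩ := exists_max_image _ (fun l => θ k₀ * d l - f δ l) hne
        exact ⟨c, fun _ => ⟨(mem_filter.mp hc).2, fun l hl => hmax l (mem_filter.mpr ⟨mem_univ _, hl⟩)⟩⟩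
      · exact ⟨l₀, fun h => absurd h hP⟩
    choose c hc using hsel
    -- on the level, `c` is an argmax of the present classes at EVERY chain slope
    have hcmax : ∀ k ∈ S, ∀ δ : ℤ, -(m : ℤ) ≤ δ ∧ δ ≤ m → Pres δ →
        ∀ l, g δ l ≠ 0 → θ k * d l - f δ l ≤ θ k * d (c δ) - f δ (c δ) := by
      intro k hk δ hδ hP l hl
      have hkL : lev k = L := (mem_filter.mp hk).2
      have hpat := cmp_iff (θ k) (θ k₀) (hlev_eq k k₀ (hkL.trans hk₀L.symm)) δ hδ (c δ) l
      exact hpat.mpr ((hc δ hP).2 l hl)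
    -- A1: the class map of a chain term on the level IS `c ∘ displacement`
    have hA1 : ∀ k ∈ S, ∀ b, (p k).2 b = c (((p k).1 b : ℤ) - (b : ℤ)) := by
      intro k hk b
      by_contra hne
      set δ := ((p k).1 b : ℤ) - (b : ℤ) with hδdef
      have hP : Pres δ := ⟨(p k).2 b, hpres k b⟩
      have h1 := hcmax k hk δ (displ_mem_range (p k).1 b) hP ((p k).2 b) (hpres k b)
      have hpk : p k = ((p k).1, (p k).2) := rfl
      have h2 := score_lt_of_dominant d (fun a b l => f ((a : ℤ) - b) l) (fun a b l => g ((a : ℤ) - b) l) (θ k)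
        (p k).1 (p k).2 (hpk ▸ hdom k) b (c δ) (hc δ hP).1 (Ne.symm hne)
      linarith
    -- A2: on the level, each chain permutation is the unique optimum of the linear instance `(d ∘ c, −f(·, c ·))`
    have hA2 : ∀ k ∈ S, ∀ σ' : Equiv.Perm (Fin m), σ' ≠ (p k).1 → (∀ b, Pres ((σ' b : ℤ) - (b : ℤ))) →
        ∑ b, (θ k * (d (c ((σ' b : ℤ) - (b : ℤ))) : ℤ) + -f ((σ' b : ℤ) - (b : ℤ)) (c ((σ' b : ℤ) - (b : ℤ)))) <
        ∑ b, (θ k * (d (c (((p k).1 b : ℤ) - (b : ℤ))) : ℤ) + -f (((p k).1 b : ℤ) - (b : ℤ)) (c (((p k).1 b : ℤ) - (b : ℤ)))) := by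
      intro k hk σ' hσ' hP
      -- the competitor term with the selected classes
      set q : Equiv.Perm (Fin m) × (Fin m → Fin K) := (σ', fun b => c ((σ' b : ℤ) - (b : ℤ))) with hq
      have hqpres : termSign (fun a b l => g ((a : ℤ) - b) l) q ≠ 0 := by
        unfold termSign
        refine mul_ne_zero (Units.ne_zero _) ?_
        rw [prod_ne_zero_iff]
        intro b _
        exact (hc _ (hP b)).1
      have hne : q ≠ p k := by
        intro h
        exact hσ' (congrArg Prod.fst h)
      have hlt := (hdom k).2 q hne hqpres
      rw [tropWeight_eq_sum, tropWeight_eq_sum] at hlt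
      have e1 : ∀ b, θ k * (d (q.2 b) : ℤ) - f ((q.1 b : ℤ) - b) (q.2 b) =
          θ k * (d (c ((σ' b : ℤ) - (b : ℤ))) : ℤ) + -f ((σ' b : ℤ) - (b : ℤ)) (c ((σ' b : ℤ) - (b : ℤ))) := by
        intro b; simp only [hq]; ring
      have e2 : ∀ b, θ k * (d ((p k).2 b) : ℤ) - f (((p k).1 b : ℤ) - b) ((p k).2 b) =
          θ k * (d (c (((p k).1 b : ℤ) - (b : ℤ))) : ℤ) + -f (((p k).1 b : ℤ) - (b : ℤ)) (c (((p k).1 b : ℤ) - (b : ℤ))) := by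
        intro b; rw [hA1 k hk b]; ring
      rw [sum_congr rfl (fun b _ => e1 b), sum_congr rfl (fun b _ => e2 b)] at hlt
      exact hlt
    -- re-index the level increasingly and apply `hΦ`
    have hcardS : S.card = (S.card - 1) + 1 := by omega
    let emb := S.orderEmbOfFin hcardS
    have hmemS : ∀ j, emb j ∈ S := fun j => S.orderEmbOfFin_mem hcardS j
    have key := hΦ (fun δ => (d (c δ) : ℤ)) (fun δ => -f δ (c δ)) Pres (S.card - 1) (fun j => θ (emb j))
      (fun j => (p (emb j)).1) (hθ.comp emb.strictMono) ?_ ?_ ?_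
    · omega
    · intro j j' h
      apply emb.injective
      apply hinj
      have h2 : (p (emb j)).2 = (p (emb j')).2 := by
        funext b
        rw [hA1 _ (hmemS j) b, hA1 _ (hmemS j') b]
        simp only at h
        rw [h]
      exact Prod.ext h h2
    · intro j b
      exact ⟨_, hpres (emb j) b⟩
    · intro j σ' hσ' hP
      exact hA2 (emb j) (hmemS j) σ' hσ' hP
  -- STEP B: sum over the levels
  have hcard : (univ : Finset (Fin (n + 1))).card =
      ∑ L ∈ range (2 * ((2 * m + 1) * K * K) + 1), (univ.filter fun k => lev k = L).card :=
    card_eq_sum_card_fiberwise fun k _ => mem_range.mpr (Nat.lt_succ_of_le (hlev_le k))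
  rw [card_univ, Fintype.card_fin] at hcard
  calc n + 1 = ∑ L ∈ range (2 * ((2 * m + 1) * K * K) + 1), (univ.filter fun k => lev k = L).card := hcard
    _ ≤ ∑ _L ∈ range (2 * ((2 * m + 1) * K * K) + 1), Φ := sum_le_sum fun L _ => level_bound L
    _ = (2 * ((2 * m + 1) * K * K) + 1) * Φ := by rw [sum_const, card_range, smul_eq_mul]

end Reduction

end Summit.ValiantsHypothesis.ValiantsHypothesis.Theorems.KPlusLogSqLaw
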